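import Summits.QuantumAdvantage.QuantumAdvantage.Theorems.SosSandwichPseudoBoundedAAClassicalCornerL2OSSSNoGoBalancedStep
import HarnessLib

/-!
# Crux `PseudoBoundedAA` (stmt-QuantumAdvantage-15237, route SosSandwich) — the `L²`-OSSS question on the classical
# corner: NO-GO for the UN-normalised per-tree route with a BALANCED tree, part 2/3 — the recursive address tree

Support file (`--supports stmt-QuantumAdvantage-15237`), sequel of `…ClassicalCornerL2OSSSNoGoBalancedStep.lean` (the
gluing step on a fixed cube).  Here: the totals of the gluing step (`glue_totals`: with `Wⱼ(t) = #{x : j ∈ t.queries x}`,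
`Iⱼ = Σₓ(ΔⱼF)²`, `Pⱼ = ΣₓΔⱼgΔⱼF`, `Sⱼ = Σₓ(Δⱼg)²`: `ΣW'I' = 4^N/2 + Σ_c ΣWI_c/4`, `ΣW'P' = 4^N/2 + Σ_c(ΣWP_c + ΣWI_c)/4`,
`ΣW'S' = 4^N/2 + Σ_c(ΣWS_c + ΣWP_c + ΣWI_c/2)/2`), the base case (`base_dictator`), and the induction over blocks of a
fixed cube (**`exists_recAddress`**): for every block `B` with `|B| ≥ 2^{k+1} − 1` there are a tree `t` of depth `k+1`
querying only `B` — the depth-`(k+1)` RECURSIVE BINARY ADDRESS TREE (`T_1` = dictator; `T_{k+1}` = query a fresh address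
bit, then a fresh copy of `T_k` on the selected one of two disjoint sub-blocks) — with `0/1` output `F` of mean `½`, and
its companion `g` (the sum of the outputs of ALL subtrees), with
`2^N Σ F g − Σ F Σ g = 4^N (k+1)/4`, `Σⱼ WⱼIⱼ ≤ 4^N`, `Σⱼ WⱼPⱼ ≤ 2·4^N`, `Σⱼ WⱼSⱼ ≤ 3(k+1)·4^N`
(normalised: `Cov[F,g] = (k+1)/4`, `Σⱼ δⱼ Infⱼ[g] ≤ 3(k+1)`; the scalar recursions are `i' = i/2 + ½`, `p' = (p+i)/2 + ½`,
`s' = s + p + i/2 + ½`).  The no-go conclusions are drawn in part 3 (`…ClassicalCornerL2OSSSNoGoBalanced.lean`).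

Honest label: calibration (no-go for a proof strategy) in the classical corner of an open conjecture; nothing is closed.
Sources: O'Donnell–Saks–Schramm–Servedio, FOCS 2005, Thm 3.2; R. O'Donnell, *Analysis of Boolean Functions* (2014) §8.6.
-/

set_option linter.dupNamespace false

noncomputable section

namespace Summit.QuantumAdvantage.QuantumAdvantage.Theorems.SosSandwich

open Finset Function
open Literature.Computability.Complexity

namespace ClassicalCornerL2OSSSNoGoBalanced

variable {N : ℕ}

/-! ### Totals of the gluing step -/

/-- A tree supported on `B` never queries a coordinate outside `B`: its query weight there is `0`. [folklore] -/
theorem card_queries_eq_zero_of_not_mem {B : Finset (Fin N)} {t : DecisionTree N}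
    (hq : ∀ x j, j ∈ t.queries x → j ∈ B) {j : Fin N} (hj : j ∉ B) :
    ((Finset.univ.filter fun x : Fin N → Bool => j ∈ t.queries x).card : ℝ) = 0 := by
  rw [Nat.cast_eq_zero, Finset.card_eq_zero, Finset.filter_eq_empty_iff]
  exact fun x _ h => hj (hq x j h)

/-- Splitting a sum over coordinates at the address bit. [folklore] -/
theorem sum_eq_add_of_eq_off (a : Fin N) (f u : Fin N → ℝ) (A : ℝ) (hfa : f a = A)
    (hf : ∀ j, j ≠ a → f j = u j) (hua : u a = 0) : ∑ j, f j = A + ∑ j, u j := by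
  classical
  rw [← Finset.add_sum_erase Finset.univ f (Finset.mem_univ a),
    ← Finset.add_sum_erase Finset.univ u (Finset.mem_univ a), hfa, hua, zero_add]
  congr 1
  exact Finset.sum_congr rfl fun j hj => hf j (Finset.ne_of_mem_erase hj)

section Glue

variable {Bl : Bool → Finset (Fin N)} {a : Fin N} {t : Bool → DecisionTree N}
  {g F : Bool → (Fin N → Bool) → ℝ} {g' F' : (Fin N → Bool) → ℝ}

/-- **Totals of the gluing step**: with `Wⱼ(t) = #{x : j ∈ t.queries x}`, `Iⱼ = Σ(ΔⱼF)²`, `Pⱼ = ΣΔⱼgΔⱼF`, `Sⱼ = Σ(Δⱼg)²`,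
`Σⱼ W'I' = 4^N/2 + (ΣWI₀ + ΣWI₁)/4`, `Σⱼ W'P' = 4^N/2 + Σ_c(ΣWP_c + ΣWI_c)/4`,
`Σⱼ W'S' = 4^N/2 + Σ_c(ΣWS_c + ΣWP_c + ΣWI_c/2)/2`. [folklore] -/
theorem glue_totals (hdis : Disjoint (Bl false) (Bl true)) (ha : ∀ c, a ∉ Bl c)
    (hq : ∀ c x j, j ∈ (t c).queries x → j ∈ Bl c)
    (hF : ∀ c x, F c x = if (t c).eval x = true then (1 : ℝ) else 0)
    (hg : ∀ c (x y : Fin N → Bool), (∀ i ∈ Bl c, x i = y i) → g c x = g c y)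
    (hF' : ∀ x, F' x = if (DecisionTree.query a (t false) (t true)).eval x = true then (1 : ℝ) else 0)
    (hg' : ∀ x, g' x = g false x + g true x + F' x)
    (hmean : ∀ c, ∑ x, F c x = (2 : ℝ) ^ N / 2) :
    (∑ j, ((Finset.univ.filter fun x : Fin N → Bool =>
        j ∈ (DecisionTree.query a (t false) (t true)).queries x).card : ℝ) *
        ∑ x, (F' (update x j true) - F' (update x j false)) ^ 2) =
      (4 : ℝ) ^ N / 2 +
        ((∑ j, ((Finset.univ.filter fun x : Fin N → Bool => j ∈ (t false).queries x).card : ℝ) *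
            ∑ x, (F false (update x j true) - F false (update x j false)) ^ 2) +
          ∑ j, ((Finset.univ.filter fun x : Fin N → Bool => j ∈ (t true).queries x).card : ℝ) *
            ∑ x, (F true (update x j true) - F true (update x j false)) ^ 2) / 4 ∧
    (∑ j, ((Finset.univ.filter fun x : Fin N → Bool =>
        j ∈ (DecisionTree.query a (t false) (t true)).queries x).card : ℝ) *
        ∑ x, (g' (update x j true) - g' (update x j false)) * (F' (update x j true) - F' (update x j false))) =
      (4 : ℝ) ^ N / 2 +
        ((∑ j, ((Finset.univ.filter fun x : Fin N → Bool => j ∈ (t false).queries x).card : ℝ) *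
            ((∑ x, (g false (update x j true) - g false (update x j false)) *
                (F false (update x j true) - F false (update x j false))) +
              ∑ x, (F false (update x j true) - F false (update x j false)) ^ 2)) +
          ∑ j, ((Finset.univ.filter fun x : Fin N → Bool => j ∈ (t true).queries x).card : ℝ) *
            ((∑ x, (g true (update x j true) - g true (update x j false)) *
                (F true (update x j true) - F true (update x j false))) +
              ∑ x, (F true (update x j true) - F true (update x j false)) ^ 2)) / 4 ∧
    (∑ j, ((Finset.univ.filter fun x : Fin N → Bool =>
        j ∈ (DecisionTree.query a (t false) (t true)).queries x).card : ℝ) *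
        ∑ x, (g' (update x j true) - g' (update x j false)) ^ 2) =
      (4 : ℝ) ^ N / 2 +
        ((∑ j, ((Finset.univ.filter fun x : Fin N → Bool => j ∈ (t false).queries x).card : ℝ) *
            ((∑ x, (g false (update x j true) - g false (update x j false)) ^ 2) +
              (∑ x, (g false (update x j true) - g false (update x j false)) *
                (F false (update x j true) - F false (update x j false))) +
              (∑ x, (F false (update x j true) - F false (update x j false)) ^ 2) / 2)) +
          ∑ j, ((Finset.univ.filter fun x : Fin N → Bool => j ∈ (t true).queries x).card : ℝ) *
            ((∑ x, (g true (update x j true) - g true (update x j false)) ^ 2) +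
              (∑ x, (g true (update x j true) - g true (update x j false)) *
                (F true (update x j true) - F true (update x j false))) +
              (∑ x, (F true (update x j true) - F true (update x j false)) ^ 2) / 2)) / 2 := by
  classical
  have hW0 : ∀ c j, j ∉ Bl c →
      ((Finset.univ.filter fun x : Fin N → Bool => j ∈ (t c).queries x).card : ℝ) = 0 :=
    fun c j hj => card_queries_eq_zero_of_not_mem (hq c) hj
  obtain ⟨hWa, hIa, hPa, hSa⟩ := glue_sums_addr hdis ha hq hF hg hF' hg' hmean
  have h4 : (4 : ℝ) ^ N = (2 : ℝ) ^ N * (2 : ℝ) ^ N := by rw [← mul_pow]; norm_num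
  -- off the address bit, each coordinate lies outside one of the two blocks
  have hcase : ∀ j, j ≠ a → ∃ c : Bool, j ∉ Bl (!c) ∧
      ((Finset.univ.filter fun x : Fin N → Bool => j ∈ (t (!c)).queries x).card : ℝ) = 0 := by
    intro j _
    by_cases hj : j ∈ Bl true
    · exact ⟨true, fun h => Finset.disjoint_left.mp hdis h hj, hW0 false j
        fun h => Finset.disjoint_left.mp hdis h hj⟩
    · exact ⟨false, hj, hW0 true j hj⟩
  refine ⟨?_, ?_, ?_⟩
  · refine (sum_eq_add_of_eq_off a _ (fun j =>
      (((Finset.univ.filter fun x : Fin N → Bool => j ∈ (t false).queries x).card : ℝ) *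
          ∑ x, (F false (update x j true) - F false (update x j false)) ^ 2 +
        ((Finset.univ.filter fun x : Fin N → Bool => j ∈ (t true).queries x).card : ℝ) *
          ∑ x, (F true (update x j true) - F true (update x j false)) ^ 2) / 4)
      ((4 : ℝ) ^ N / 2) (by rw [hWa, hIa, h4]; ring) (fun j hja => ?_)
      (by rw [hW0 false a (ha false), hW0 true a (ha true)]; ring)).trans ?_
    · obtain ⟨c, hjc, hWz⟩ := hcase j hja
      obtain ⟨hW, hI, -, -⟩ := glue_sums_block ha hq hF hg hF' hg' c hjc hja
      rw [hW, hI]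
      cases c
      · simp only [Bool.not_false] at hWz; rw [hWz]; ring
      · simp only [Bool.not_true] at hWz; rw [hWz]; ring
    · rw [← Finset.sum_div, Finset.sum_add_distrib]
  · refine (sum_eq_add_of_eq_off a _ (fun j =>
      (((Finset.univ.filter fun x : Fin N → Bool => j ∈ (t false).queries x).card : ℝ) *
          ((∑ x, (g false (update x j true) - g false (update x j false)) *
              (F false (update x j true) - F false (update x j false))) +
            ∑ x, (F false (update x j true) - F false (update x j false)) ^ 2) +
        ((Finset.univ.filter fun x : Fin N → Bool => j ∈ (t true).queries x).card : ℝ) *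
          ((∑ x, (g true (update x j true) - g true (update x j false)) *
              (F true (update x j true) - F true (update x j false))) +
            ∑ x, (F true (update x j true) - F true (update x j false)) ^ 2)) / 4)
      ((4 : ℝ) ^ N / 2) (by rw [hWa, hPa, h4]; ring) (fun j hja => ?_)
      (by rw [hW0 false a (ha false), hW0 true a (ha true)]; ring)).trans ?_
    · obtain ⟨c, hjc, hWz⟩ := hcase j hja
      obtain ⟨hW, -, hP, -⟩ := glue_sums_block ha hq hF hg hF' hg' c hjc hja
      rw [hW, hP]
      cases c
      · simp only [Bool.not_false] at hWz; rw [hWz]; ring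
      · simp only [Bool.not_true] at hWz; rw [hWz]; ring
    · rw [← Finset.sum_div, Finset.sum_add_distrib]
  · refine (sum_eq_add_of_eq_off a _ (fun j =>
      (((Finset.univ.filter fun x : Fin N → Bool => j ∈ (t false).queries x).card : ℝ) *
          ((∑ x, (g false (update x j true) - g false (update x j false)) ^ 2) +
            (∑ x, (g false (update x j true) - g false (update x j false)) *
              (F false (update x j true) - F false (update x j false))) +
            (∑ x, (F false (update x j true) - F false (update x j false)) ^ 2) / 2) +
        ((Finset.univ.filter fun x : Fin N → Bool => j ∈ (t true).queries x).card : ℝ) *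
          ((∑ x, (g true (update x j true) - g true (update x j false)) ^ 2) +
            (∑ x, (g true (update x j true) - g true (update x j false)) *
              (F true (update x j true) - F true (update x j false))) +
            (∑ x, (F true (update x j true) - F true (update x j false)) ^ 2) / 2)) / 2)
      ((4 : ℝ) ^ N / 2) (by rw [hWa, hSa, h4]; ring) (fun j hja => ?_)
      (by rw [hW0 false a (ha false), hW0 true a (ha true)]; ring)).trans ?_
    · obtain ⟨c, hjc, hWz⟩ := hcase j hja
      obtain ⟨hW, -, -, hS⟩ := glue_sums_block ha hq hF hg hF' hg' c hjc hja
      rw [hW, hS]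
      cases c
      · simp only [Bool.not_false] at hWz; rw [hWz]; ring
      · simp only [Bool.not_true] at hWz; rw [hWz]; ring
    · rw [← Finset.sum_div, Finset.sum_add_distrib]

end Glue

/-! ### The base case: a dictator -/

/-- **Base case.** The dictator tree on a coordinate `d ∈ B` (depth `1`, companion `g = F`) satisfies the invariants
with `Cov = 4^N/4` and all three weighted totals equal to `4^N`. [folklore] -/
theorem base_dictator (B : Finset (Fin N)) {d : Fin N} (hd : d ∈ B) :
    ∃ (t : DecisionTree N) (g F : (Fin N → Bool) → ℝ), t.depth = 1 ∧
      (∀ x, F x = if t.eval x = true then (1 : ℝ) else 0) ∧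
      (∀ x j, j ∈ t.queries x → j ∈ B) ∧
      (∀ x y : Fin N → Bool, (∀ i ∈ B, x i = y i) → g x = g y) ∧
      ∑ x, F x = (2 : ℝ) ^ N / 2 ∧
      (2 : ℝ) ^ N * (∑ x, F x * g x) - (∑ x, F x) * (∑ x, g x) = (4 : ℝ) ^ N * ((0 : ℝ) + 1) / 4 ∧
      (∑ j, ((Finset.univ.filter fun x : Fin N → Bool => j ∈ t.queries x).card : ℝ) *
          ∑ x, (F (update x j true) - F (update x j false)) ^ 2) ≤ (4 : ℝ) ^ N ∧
      (∑ j, ((Finset.univ.filter fun x : Fin N → Bool => j ∈ t.queries x).card : ℝ) *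
          ∑ x, (g (update x j true) - g (update x j false)) * (F (update x j true) - F (update x j false))) ≤
        2 * (4 : ℝ) ^ N ∧
      (∑ j, ((Finset.univ.filter fun x : Fin N → Bool => j ∈ t.queries x).card : ℝ) *
          ∑ x, (g (update x j true) - g (update x j false)) ^ 2) ≤ 3 * ((0 : ℝ) + 1) * (4 : ℝ) ^ N := by
  classical
  set t : DecisionTree N := DecisionTree.query d (DecisionTree.leaf false) (DecisionTree.leaf true) with htdef
  obtain ⟨F, hF⟩ : ∃ F : (Fin N → Bool) → ℝ, ∀ x, F x = if x d = true then (1 : ℝ) else 0 := ⟨_, fun _ => rfl⟩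
  have hev : ∀ x, (t.eval x = true) ↔ x d = true := by
    intro x
    rw [htdef, DecisionTree.eval_query]
    rcases Bool.eq_false_or_eq_true (x d) with h | h <;> simp [h]
  have hFt : ∀ x, F x = if t.eval x = true then (1 : ℝ) else 0 := by
    intro x; rw [hF]; simp only [hev x]
  have hq : ∀ x j, j ∈ t.queries x → j = d := by
    intro x j hj
    rw [htdef, DecisionTree.queries_query, Finset.mem_insert] at hj
    rcases hj with h | h
    · exact h
    · split_ifs at h <;> simp at h
  have hdep : ∀ x y : Fin N → Bool, (∀ i ∈ B, x i = y i) → F x = F y := by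
    intro x y h; rw [hF, hF, h d hd]
  have h2N : (0 : ℝ) < (2 : ℝ) ^ N := by positivity
  have h4 : (4 : ℝ) ^ N = (2 : ℝ) ^ N * (2 : ℝ) ^ N := by rw [← mul_pow]; norm_num
  -- `Σ F = 2^N/2`
  have hmean : ∑ x, F x = (2 : ℝ) ^ N / 2 := by
    rw [Finset.sum_congr rfl fun x _ => hF x,
      sum_ite_eq_half d true (fun _ => (1 : ℝ)) (fun _ _ => rfl), Finset.sum_const, Finset.card_univ,
      BooleanCorner.card_cube_nat, nsmul_eq_mul, mul_one]
    push_cast; ring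
  have hsq : ∀ x, F x * F x = F x := by intro x; rw [hF]; split_ifs <;> norm_num
  -- increments: `Δ_d F = 1`, `Δ_j F = 0` for `j ≠ d`
  have hΔd : ∀ x, F (update x d true) - F (update x d false) = 1 := by
    intro x; rw [hF, hF]; simp
  have hWd : ((Finset.univ.filter fun x : Fin N → Bool => d ∈ t.queries x).card : ℝ) = (2 : ℝ) ^ N := by
    have hall : (Finset.univ.filter fun x : Fin N → Bool => d ∈ t.queries x) = Finset.univ := by
      refine Finset.filter_true_of_mem fun x _ => ?_
      rw [htdef, DecisionTree.queries_query]
      exact Finset.mem_insert_self _ _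
    rw [hall, Finset.card_univ, BooleanCorner.card_cube_nat]; push_cast; ring
  have hW0 : ∀ j, j ≠ d → ((Finset.univ.filter fun x : Fin N → Bool => j ∈ t.queries x).card : ℝ) = 0 := by
    intro j hj
    rw [Nat.cast_eq_zero, Finset.card_eq_zero, Finset.filter_eq_empty_iff]
    exact fun x _ h => hj (hq x j h)
  have htotal : ∑ j, ((Finset.univ.filter fun x : Fin N → Bool => j ∈ t.queries x).card : ℝ) *
      ∑ x, (F (update x j true) - F (update x j false)) ^ 2 = (4 : ℝ) ^ N := by
    rw [sum_eq_add_of_eq_off d _ (fun _ => (0 : ℝ)) ((4 : ℝ) ^ N) ?_ (fun j hj => by rw [hW0 j hj, zero_mul])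
      rfl, Finset.sum_const_zero, add_zero]
    rw [hWd, Finset.sum_congr rfl fun x _ => by rw [hΔd x], one_pow, Finset.sum_const, Finset.card_univ,
      BooleanCorner.card_cube_nat, nsmul_eq_mul, mul_one, h4]
    push_cast; ring
  have h4pos : (0 : ℝ) < (4 : ℝ) ^ N := by positivity
  refine ⟨t, F, F, by rw [htdef, DecisionTree.depth_query]; simp, hFt, fun x j hj => by rw [hq x j hj]; exact hd,
    hdep, hmean, ?_, le_of_eq htotal, ?_, ?_⟩
  · rw [Finset.sum_congr rfl fun x _ => hsq x, hmean, h4]; ring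
  · rw [Finset.sum_congr rfl fun j _ => by rw [Finset.sum_congr rfl fun x _ => by rw [← sq]], htotal]; linarith
  · rw [htotal]; linarith

/-! ### The induction over blocks of a fixed cube -/

/-- **The recursive binary address tree on a block.** For every block `B` of at least `2^{k+1} − 1` coordinates there
are a decision tree `t` of depth `k+1` querying only `B`, with `0/1` output `F` of mean `½`, and a companion `g`
depending only on `B`, with `2^N Σ F g − Σ F Σ g = 4^N (k+1)/4`, `Σⱼ WⱼΣₓ(ΔⱼF)² ≤ 4^N`, `Σⱼ WⱼΣₓΔⱼgΔⱼF ≤ 2·4^N`,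
`Σⱼ WⱼΣₓ(Δⱼg)² ≤ 3(k+1)·4^N` (`t` = the depth-`(k+1)` recursive address tree, `g` = the sum of the outputs of all its
subtrees). [folklore] -/
theorem exists_recAddress (k : ℕ) : ∀ (B : Finset (Fin N)), 2 ^ (k + 1) - 1 ≤ B.card →
    ∃ (t : DecisionTree N) (g F : (Fin N → Bool) → ℝ), t.depth = k + 1 ∧
      (∀ x, F x = if t.eval x = true then (1 : ℝ) else 0) ∧
      (∀ x j, j ∈ t.queries x → j ∈ B) ∧
      (∀ x y : Fin N → Bool, (∀ i ∈ B, x i = y i) → g x = g y) ∧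
      ∑ x, F x = (2 : ℝ) ^ N / 2 ∧
      (2 : ℝ) ^ N * (∑ x, F x * g x) - (∑ x, F x) * (∑ x, g x) = (4 : ℝ) ^ N * ((k : ℝ) + 1) / 4 ∧
      (∑ j, ((Finset.univ.filter fun x : Fin N → Bool => j ∈ t.queries x).card : ℝ) *
          ∑ x, (F (update x j true) - F (update x j false)) ^ 2) ≤ (4 : ℝ) ^ N ∧
      (∑ j, ((Finset.univ.filter fun x : Fin N → Bool => j ∈ t.queries x).card : ℝ) *
          ∑ x, (g (update x j true) - g (update x j false)) * (F (update x j true) - F (update x j false))) ≤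
        2 * (4 : ℝ) ^ N ∧
      (∑ j, ((Finset.univ.filter fun x : Fin N → Bool => j ∈ t.queries x).card : ℝ) *
          ∑ x, (g (update x j true) - g (update x j false)) ^ 2) ≤ 3 * ((k : ℝ) + 1) * (4 : ℝ) ^ N := by
  classical
  induction k with
  | zero =>
    intro B hB
    have hB1 : 0 < B.card := lt_of_lt_of_le (by norm_num) hB
    obtain ⟨d, hd⟩ := Finset.card_pos.mp hB1
    simpa using base_dictator B hd
  | succ k ih =>
    intro B hB
    -- room: `|B| ≥ 2^{k+2} − 1 = 1 + 2·(2^{k+1} − 1)`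
    have hpow : 2 ^ (k + 1 + 1) = 2 * 2 ^ (k + 1) := by ring
    have hpos : 1 ≤ 2 ^ (k + 1) := Nat.one_le_two_pow
    have hB1 : 0 < B.card := by
      have h2 : 2 ≤ 2 ^ (k + 1 + 1) := by rw [hpow]; omega
      omega
    obtain ⟨a, haB⟩ := Finset.card_pos.mp hB1
    have hcard' : 2 * (2 ^ (k + 1) - 1) ≤ (B.erase a).card := by
      rw [Finset.card_erase_of_mem haB]; omega
    obtain ⟨B₀, hB₀sub, hB₀card⟩ :=
      Finset.exists_subset_card_eq (s := B.erase a) (n := 2 ^ (k + 1) - 1) (by omega)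
    set B₁ : Finset (Fin N) := B.erase a \ B₀ with hB₁def
    have hB₁card : 2 ^ (k + 1) - 1 ≤ B₁.card := by
      rw [hB₁def, Finset.card_sdiff_of_subset hB₀sub]; omega
    -- Bool-indexed blocks
    set Bl : Bool → Finset (Fin N) := fun c => bif c then B₁ else B₀ with hBl
    have hBlsub : ∀ c, Bl c ⊆ B.erase a := by
      intro c; cases c
      · exact hB₀sub
      · exact Finset.sdiff_subset
    have hBlB : ∀ c, Bl c ⊆ B := fun c => (hBlsub c).trans (Finset.erase_subset a B)
    have ha : ∀ c, a ∉ Bl c := fun c h => Finset.notMem_erase a B (hBlsub c h)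
    have hdis : Disjoint (Bl false) (Bl true) := by
      change Disjoint B₀ (B.erase a \ B₀)
      exact Finset.disjoint_sdiff
    have hBlcard : ∀ c, 2 ^ (k + 1) - 1 ≤ (Bl c).card := by
      intro c; cases c
      · exact hB₀card.ge
      · exact hB₁card
    -- the two sub-blocks
    have ih2 : ∀ c : Bool, ∃ (t : DecisionTree N) (g F : (Fin N → Bool) → ℝ), t.depth = k + 1 ∧
        (∀ x, F x = if t.eval x = true then (1 : ℝ) else 0) ∧
        (∀ x j, j ∈ t.queries x → j ∈ Bl c) ∧
        (∀ x y : Fin N → Bool, (∀ i ∈ Bl c, x i = y i) → g x = g y) ∧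
        ∑ x, F x = (2 : ℝ) ^ N / 2 ∧
        (2 : ℝ) ^ N * (∑ x, F x * g x) - (∑ x, F x) * (∑ x, g x) = (4 : ℝ) ^ N * ((k : ℝ) + 1) / 4 ∧
        (∑ j, ((Finset.univ.filter fun x : Fin N → Bool => j ∈ t.queries x).card : ℝ) *
            ∑ x, (F (update x j true) - F (update x j false)) ^ 2) ≤ (4 : ℝ) ^ N ∧
        (∑ j, ((Finset.univ.filter fun x : Fin N → Bool => j ∈ t.queries x).card : ℝ) *
            ∑ x, (g (update x j true) - g (update x j false)) * (F (update x j true) - F (update x j false))) ≤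
          2 * (4 : ℝ) ^ N ∧
        (∑ j, ((Finset.univ.filter fun x : Fin N → Bool => j ∈ t.queries x).card : ℝ) *
            ∑ x, (g (update x j true) - g (update x j false)) ^ 2) ≤ 3 * ((k : ℝ) + 1) * (4 : ℝ) ^ N :=
      fun c => ih (Bl c) (hBlcard c)
    choose t g F hdepth hF hq hg hmean hcov hI hP hS using ih2
    -- the glued pair
    obtain ⟨F', hF'⟩ : ∃ F' : (Fin N → Bool) → ℝ,
        ∀ x, F' x = if (DecisionTree.query a (t false) (t true)).eval x = true then (1 : ℝ) else 0 :=
      ⟨_, fun _ => rfl⟩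
    obtain ⟨g', hg'⟩ : ∃ g' : (Fin N → Bool) → ℝ, ∀ x, g' x = g false x + g true x + F' x := ⟨_, fun _ => rfl⟩
    obtain ⟨hmean', hcov'⟩ := glue_cov hdis ha hq hF hg hF' hg' hmean
    obtain ⟨hI', hP', hS'⟩ := glue_totals hdis ha hq hF hg hF' hg' hmean
    refine ⟨DecisionTree.query a (t false) (t true), g', F', ?_, hF', ?_, ?_, hmean', ?_, ?_, ?_, ?_⟩
    · rw [DecisionTree.depth_query, hdepth, hdepth, max_self]
    · exact glue_queries_subset (hq false) (hq true) (hBlB false) (hBlB true) haB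
    · exact glue_dep (hq false) (hq true) (hg false) (hg true) (hBlB false) (hBlB true) haB hF' hg'
    · rw [hcov', hcov, hcov]; push_cast; ring
    · rw [hI']; linarith [hI false, hI true]
    · rw [hP']
      simp only [mul_add, Finset.sum_add_distrib]
      linarith [hI false, hI true, hP false, hP true]
    · rw [hS']
      simp only [mul_add, Finset.sum_add_distrib, mul_div_assoc']
      rw [← Finset.sum_div, ← Finset.sum_div]
      push_cast
      linarith [hI false, hI true, hP false, hP true, hS false, hS true]

end ClassicalCornerL2OSSSNoGoBalanced

end Summit.QuantumAdvantage.QuantumAdvantage.Theorems.SosSandwich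

end
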